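import Summits.MatrixMultiplication.OmegaCensus.STPPVosperSlackOneKillsZ61
import Summits.MatrixMultiplication.OmegaCensus.STPPVosperSlackOneLawMult

/-!
# ω-census (abelian STPP census): the slack-1 law with the Hamidoune–Rødseth hypothesis restricted to ONE cardinality, and the two GO #91 leaves modulo `|S| = 3` only (kernel)

HONEST FRAMING (pub-omega census; verbatim): lottery ticket; floor = certified bounds/negative ranges.
Census STRUCTURE (seat pub-omega-stpp-1 gen 30, 2026-08-28), family (b2).  The slack-1 laws (`STPPVosperSlackOneLaw*.lean`) take the full Hamidoune–Rødseth
inverse theorem `HamidouneRodsethInverseTheorem` as a hypothesis, but each application uses it for exactly TWO cardinalities of the smaller summand: `|−Aᵢ| = a`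
(case α) and `|Bᵢ| = b` (case β).  This file makes that dependence explicit — `HamidouneRodsethCard k` is the published theorem RESTRICTED to `|S| = k` (a
special case, NOT a new claim; `hamidouneRodsethCard_of_inverseTheorem`) — and restates the law and the three `(3,3,2)`-block kills of
`STPPVosperSlackOneKillsZ61.lean` modulo `HamidouneRodsethCard 3` ALONE.  So the one upstream item that makes the two leaves of the `ℤ₆₁` front open on both axes
(OMEGA-TABLE NR257/NR258) KERNEL-dead is: the Hamidoune–Rødseth theorem for three-element sets `S` (`|S| = 3`, `|T| ≥ 4`, `|S + T| = |T| + 3 ≤ p − 4` ⇒ `S` inside a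
4-term and `T` inside a `(|T|+1)`-term progression with one common difference).  Nothing here is progress on `ω`; every theorem is conditional.

References: Y. O. Hamidoune, Ø. J. Rødseth, Acta Arith. 92 (2000) 251–262; O. Serra, G. Zémor, Integers 0 (2000) A10, Thm 3; A. G. Vosper, J. London
Math. Soc. 31 (1956); M. B. Nathanson, GTM 165, Thm 2.7; H. Cohn, R. Kleinberg, B. Szegedy, C. Umans, FOCS 2005 (arXiv:math/0511460), Def. 5.1.
-/

open Finset
open scoped Pointwise

namespace Summit.MatrixMultiplication.OmegaCensus.CubeNB

open Literature.Computability.AlgebraicComplexity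
open Literature.Combinatorics.Additive
open Summit.MatrixMultiplication.OmegaCensus.STPPKneser

/-- **The Hamidoune–Rødseth inverse theorem restricted to `|S| = k`**: the statement of `HamidouneRodsethInverseTheorem` (Hamidoune–Rødseth 2000 =
Serra–Zémor 2000 Thm 3, as printed in `STPPVosperSlackOneSteps.lean`) for sets `S` of exactly `k` elements (`k ≥ 3`).  A SPECIAL CASE of the published
theorem, isolated because the census kills need only `k = 3` (and `k = 4`); NOT proved in the tree.
[cite: HamidouneRodseth2000, main theorem (§1, p. 252), case |S| = k] [cite: SerraZemor2000, Theorem 3 (p. 2)] -/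
def HamidouneRodsethCard (k : ℕ) : Prop :=
  ∀ (p : ℕ) [Fact p.Prime] (S T : Finset (ZMod p)), #S = k → 3 ≤ #T → 7 ≤ #(S + T) → #(S + T) ≤ p - 4 → #(S + T) ≤ #S + #T →
    ∃ d s t : ZMod p, S ⊆ apFinset s d (#S + 1) ∧ T ⊆ apFinset t d (#T + 1)

/-- The full theorem gives every restricted case with `k ≥ 3`. [cite: HamidouneRodseth2000, main theorem (§1, p. 252)] -/
theorem hamidouneRodsethCard_of_inverseTheorem (h : HamidouneRodsethInverseTheorem) {k : ℕ} (hk : 3 ≤ k) : HamidouneRodsethCard k :=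
  fun p _ S T hS hT h7 hp4 hle => h p S T (by omega) hT h7 hp4 hle

variable {p : ℕ} [hp : Fact p.Prime]

/-! ## The law with restricted hypotheses -/

/-- **The slack-1 Vosper law (enlarged target) with the Hamidoune–Rødseth hypothesis RESTRICTED to the two cardinalities actually used:**
`HamidouneRodsethCard a` (for the pair `(−Aᵢ, Y°)`, `|−Aᵢ| = a`) and `HamidouneRodsethCard b` (for `(Bᵢ, V)`, `|Bᵢ| = b`).  Otherwise identical to
`no_isSTPP_of_slack_one_tables_prime_mult`.
[cite: CohnKleinbergSzegedyUmans2005, Def. 5.1] [cite: Vosper1956, main theorem; Nathanson1996, Thm 2.7]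
[cite: HamidouneRodseth2000, main theorem (§1, p. 252); SerraZemor2000, Theorem 3] -/
theorem no_isSTPP_of_slack_one_tables_prime_card {a b : ℕ} (hHRa : HamidouneRodsethCard a) (hHRb : HamidouneRodsethCard b) {N : ℕ} (A B C : Fin N → Finset (ZMod p))
    (hS : IsSTPP A B C) (hA : ∀ k, (A k).Nonempty) (hB : ∀ k, (B k).Nonempty) (hC : ∀ k, (C k).Nonempty)
    (i : Fin N) (hI : ((univ : Finset (Fin N)).erase i).Nonempty)
    {vol z L m n : ℕ} (ha : #(A i) = a) (hb : #(B i) = b) (hvol : #(A i) * #(B i) * #(C i) = vol)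
    (hz : ∑ k ∈ univ.erase i, #(A k) * #(C k) = z) (hL : ∑ k ∈ univ.erase i, #(B k) * #(C k) = L)
    (h3a : 3 ≤ a) (h3b : 3 ≤ b) (h4z : 4 ≤ z) (h4L : 4 ≤ L) (hslack : z + b + vol + a + L = p + 1)
    (hm : L + a = m + 1) (hn : vol + m = n) {J : Finset ℕ}
    (hJ : ∀ jv ∈ J, jv = 0 ∨ (∃ k ∈ range b, 1 ≤ k ∧ (jv = k ∨ jv + k = p)) ∨ (∃ k ∈ range a, 1 ≤ k ∧ (jv * k % p = 1 ∨ jv * k % p = p - 1)))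
    (htableγ : ∀ j < p, ∀ t < p, (∀ i' < m, (t + j * i') % p < n) →
      (∀ k < m, b ∣ (t + j * k) % p - #((range m).filter fun i' => (t + j * i') % p < (t + j * k) % p)) → j ∈ J)
    (htableα : tableAlpha p (n + 1) (m + 2) b J = true)
    (htableβ : tableBeta p (n + 1) m b J = true) : False := by
  have hp2 : 2 ≤ p := hp.out.two_le
  have hcardp : Fintype.card (ZMod p) = p := ZMod.card p
  -- the objects
  set W := ((A i) ×ˢ ((B i) ×ˢ (C i))).image fun q : ZMod p × ZMod p × ZMod p => (0 : ZMod p) + q.2.2 - q.1 - q.2.1 with hW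
  set Sn := (A i).image (fun x => (0 : ZMod p) - x) with hSn
  set Yo := DU B C (univ.erase i) with hYo
  set Zo := DU A C (univ.erase i) with hZo
  have hWcard : #W = vol := by rw [hW, card_image_blockSum hS i 0, hvol]
  have hSncard : #Sn = a := by rw [hSn, Finset.card_image_of_injective _ sub_right_injective, ha]
  have hYocard : #Yo = L := by rw [hYo, card_DU_BC hS hA, hL]
  have hZocard : #Zo = z := by rw [hZo, card_DU_AC hS hB, hz]
  have hSnne : Sn.Nonempty := (hA i).image _
  have hYone : Yo.Nonempty := DU_nonempty hI hB hC
  have hWV : Disjoint W (Sn + Yo) := disjoint_W_negA_add_DU hS i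
  have hVcard : #(W ∪ (Sn + Yo)) = vol + #(Sn + Yo) := by rw [Finset.card_union_of_disjoint hWV, hWcard]
  have hsub : B i + (W ∪ (Sn + Yo)) ⊆ univ \ Zo := B_add_W_union_negA_add_subset hS i
  have hvol1 : 1 ≤ vol := by rw [← hvol]; exact Nat.mul_pos (Nat.mul_pos (hA i).card_pos (hB i).card_pos) (hC i).card_pos
  have hU : #(univ \ Zo) = p - z := by
    rw [Finset.card_sdiff_of_subset (Finset.subset_univ _), Finset.card_univ, hcardp, hZocard]
  have hzle : z ≤ p := by have h := Finset.card_le_univ Zo; rwa [hcardp, hZocard] at h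
  have hBV_le : #(B i + (W ∪ (Sn + Yo))) ≤ p - z := hU ▸ Finset.card_le_card hsub
  -- Cauchy–Davenport twice
  have hWne : W.Nonempty := Finset.card_pos.1 (by rw [hWcard]; exact hvol1)
  have hSY_ne_univ : Sn + Yo ≠ univ := by
    intro h
    obtain ⟨x, hx⟩ := hWne
    exact Finset.disjoint_left.1 hWV hx (h ▸ Finset.mem_univ x)
  have hcd1 : #Sn + #Yo ≤ #(Sn + Yo) + 1 := Vosper.cauchy_davenport_of_ne_univ hSnne hYone hSY_ne_univ
  have hZne : Zo.Nonempty := Finset.card_pos.1 (by rw [hZocard]; omega)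
  have hVne : (W ∪ (Sn + Yo)).Nonempty := hWne.mono Finset.subset_union_left
  have hBV_ne_univ : B i + (W ∪ (Sn + Yo)) ≠ univ := by
    intro h
    obtain ⟨x, hx⟩ := hZne
    have := hsub (h ▸ Finset.mem_univ x)
    rw [Finset.mem_sdiff] at this
    exact this.2 hx
  have hcd2 : #(B i) + #(W ∪ (Sn + Yo)) ≤ #(B i + (W ∪ (Sn + Yo))) + 1 :=
    Vosper.cauchy_davenport_of_ne_univ (hB i) hVne hBV_ne_univ
  rw [hSncard, hYocard] at hcd1
  rw [hb, hVcard] at hcd2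
  -- numerology: #(Sn + Yo) ∈ {m, m+1}
  have hSYge : m ≤ #(Sn + Yo) := by omega
  have hSYle : #(Sn + Yo) ≤ m + 1 := by omega
  have hmp : m + 2 ≤ p - 4 := by omega
  -- pairs at distance k•d in Aᵢ from a structure statement on Sn
  have hApairsE : ∀ {s d : ZMod p} {K μ : ℕ}, 4 ≤ K → Sn = apErase s d K μ →
      ∀ k, 1 ≤ k → k + 2 ≤ K → ∃ α, α ∈ A i ∧ α + k • d ∈ A i := by
    intro s d K μ hK hSnE k hk1 hk
    exact pairs_of_neg_image (A := A) i (a := k + 1) (fun k' hk1' hk' => pairs_of_apErase hSnE hK k' hk1' (by omega)) k hk1 (by omega)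
  rcases Nat.eq_or_lt_of_le hSYle with hαcase | hlt
  · /- Case α: the first Cauchy–Davenport step is loose. -/
    have hVn : #(W ∪ (Sn + Yo)) = n + 1 := by rw [hVcard, hαcase]; omega
    have hBVeq : #(B i + (W ∪ (Sn + Yo))) = p - z := by omega
    have hEq : B i + (W ∪ (Sn + Yo)) = univ \ Zo := Finset.eq_of_subset_of_card_le hsub (by rw [hU, hBVeq])
    -- Vosper for (Bᵢ, V)
    have h2B : 2 ≤ #(B i) := by rw [hb]; omega
    have h2V : 2 ≤ #(W ∪ (Sn + Yo)) := by rw [hVn]; omega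
    have hcrit2 : #(B i + (W ∪ (Sn + Yo))) = #(B i) + #(W ∪ (Sn + Yo)) - 1 := by rw [hb, hVn]; omega
    have hsmall2 : #(B i + (W ∪ (Sn + Yo))) ≤ p - 2 := by omega
    obtain ⟨e', he', hBap, hVap⟩ := vosper_inverse h2B h2V hcrit2 hsmall2
    obtain ⟨β, hβ⟩ := hBap
    obtain ⟨v, hv⟩ := hVap
    rw [hb] at hβ; rw [hVn] at hv
    -- Hamidoune–Rødseth for (Sn, Yo)
    have hHR1 := hHRa p Sn Yo hSncard (by rw [hYocard]; omega) (by omega) (by omega) (by omega)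
    obtain ⟨d, s₀, y₀, hSsub, hYsub⟩ := hHR1
    rw [hSncard] at hSsub; rw [hYocard] at hYsub
    have hd : d ≠ 0 := step_ne_zero_of_subset_apFinset hSsub (by rw [hSncard]; omega)
    have hSYsub : Sn + Yo ⊆ apFinset (s₀ + y₀) d (m + 2) := by
      have h := (Finset.add_subset_add hSsub hYsub).trans (apFinset_add_apFinset_subset s₀ y₀ d (a + 1) (L + 1))
      rwa [show a + 1 + (L + 1) - 1 = m + 2 by omega] at h
    obtain ⟨μ, hμ, hSYE⟩ := eq_apErase_of_subset_apFinset hd (by omega) hSYsub (by rw [hαcase])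
    -- pairs in Aᵢ (step multiples of d) and Bᵢ (step multiples of e′)
    obtain ⟨μ₁, -, hSnE⟩ := eq_apErase_of_subset_apFinset hd (by omega : a + 1 ≤ p) hSsub (by rw [hSncard])
    have hApairs : ∀ k, 1 ≤ k → k < a → ∃ α, α ∈ A i ∧ α + k • d ∈ A i :=
      fun k hk1 hk => hApairsE (by omega) hSnE k hk1 (by omega)
    have hBpairs := pairs_of_apFinset hβ
    obtain ⟨b', rfl⟩ : ∃ b', b = b' + 1 := ⟨b - 1, by omega⟩
    -- transport and table α
    obtain ⟨hSsub', hgap⟩ := prefix_law_of_runs hS i (SY := Sn + Yo) (N₁ := n + 1) he' hβ hWV hv (by omega)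
    rw [hSYE, image_affine_apErase] at hSsub' hgap
    have hval := val_mem_of_nat_table_erase_prime (p := p) (n := n + 1) (m := m + 2) (r := b' + 1) (J := J)
      (by omega) (by omega) (tableAlpha_spec htableα) (mul_ne_zero (inv_ne_zero he') hd) hμ hSsub' hgap
    exact false_of_ratio_val_mem_mult hS i hd he' (by omega) (by omega) hJ hval hApairs hBpairs (hC i)
  · /- Cases β, γ: the first step is tight, Vosper for (Sn, Yo). -/
    have hSYm : #(Sn + Yo) = m := by omega
    have hVn : #(W ∪ (Sn + Yo)) = n := by rw [hVcard, hSYm, hn]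
    have h2S : 2 ≤ #Sn := by rw [hSncard]; omega
    have h2Yo : 2 ≤ #Yo := by rw [hYocard]; omega
    have hcrit1 : #(Sn + Yo) = #Sn + #Yo - 1 := by rw [hSncard, hYocard]; omega
    have hsmall1 : #(Sn + Yo) ≤ p - 2 := by omega
    obtain ⟨d, hd, hSap, hYap⟩ := vosper_inverse h2S h2Yo hcrit1 hsmall1
    obtain ⟨s₀, hs₀⟩ := hSap
    obtain ⟨y₀, hy⟩ := hYap
    rw [hSncard] at hs₀; rw [hYocard] at hy
    have hsubm : Sn + Yo ⊆ apFinset (s₀ + y₀) d m := by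
      have h := apFinset_add_apFinset_subset s₀ y₀ d a L
      rw [show a + L - 1 = m by omega] at h
      rwa [hs₀, hy]
    have hSY : Sn + Yo = apFinset (s₀ + y₀) d m :=
      Finset.eq_of_subset_of_card_le hsubm (by rw [hSYm, card_apFinset hd (by omega)])
    -- pairs in Aᵢ (step multiples of d): Sn is an a-term progression = (a+1)-term one minus its first term
    have hSnE : Sn = apErase (s₀ - d) d (a + 1) 0 := by rw [hs₀, apFinset_eq_apErase_zero]
    have hApairs : ∀ k, 1 ≤ k → k < a → ∃ α, α ∈ A i ∧ α + k • d ∈ A i :=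
      fun k hk1 hk => hApairsE (by omega) hSnE k hk1 (by omega)
    rcases Nat.eq_or_lt_of_le hBV_le with hβcase | hγlt
    · /- Case β: the second Cauchy–Davenport step is loose; Hamidoune–Rødseth for (Bᵢ, V). -/
      have hEq : B i + (W ∪ (Sn + Yo)) = univ \ Zo := Finset.eq_of_subset_of_card_le hsub (by rw [hU, hβcase])
      have hHR2 := hHRb p (B i) (W ∪ (Sn + Yo)) hb (by rw [hVn]; omega) (by omega) (by omega)
        (by rw [hb, hVn]; omega)
      obtain ⟨e', β, v, hBsub, hVsub⟩ := hHR2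
      rw [hb] at hBsub; rw [hVn] at hVsub
      have he' : e' ≠ 0 := step_ne_zero_of_subset_apFinset hBsub (by rw [hb]; omega)
      obtain ⟨g, hg, hBE⟩ := eq_apErase_of_subset_apFinset he' (by omega : b + 1 ≤ p) hBsub (by rw [hb])
      -- normalise the removed index away from the last slot
      obtain ⟨β₁, g₁, hg₁, hBE₁⟩ : ∃ β₁ : ZMod p, ∃ g₁ : ℕ, g₁ < b ∧ B i = apErase β₁ e' (b + 1) g₁ := by
        rcases Nat.lt_or_ge g b with hgb | hgb
        · exact ⟨β, g, hgb, hBE⟩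
        · have hgb' : g = b := by omega
          obtain ⟨b', rfl⟩ : ∃ b', b = b' + 1 := ⟨b - 1, by omega⟩
          refine ⟨β - e', 0, by omega, ?_⟩
          rw [hBE, hgb', apErase_last_eq_apErase_zero]
      have hBpairs : ∀ k, 1 ≤ k → k < b → ∃ β, β ∈ B i ∧ β + k • e' ∈ B i :=
        fun k hk1 hk => pairs_of_apErase hBE₁ (by omega) k hk1 (by omega)
      -- table β
      have hPcard : #((A i) ×ˢ (C i)) ≤ n + 1 := by
        rw [Finset.card_product]
        have h1 : #(A i) * #(C i) ≤ #(A i) * #(B i) * #(C i) := by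
          rw [mul_assoc, mul_comm (#(B i)) _, ← mul_assoc]
          exact Nat.le_mul_of_pos_right _ (hB i).card_pos
        rw [hvol] at h1
        omega
      have hval := holed_ratio_val_mem hS i (J := J) he' hd hg₁ hBE₁ hSY hWV hVsub hVn (by omega) hPcard
        (tableBeta_spec htableβ)
      exact false_of_ratio_val_mem_mult hS i hd he' (by omega) (by omega) hJ hval hApairs hBpairs (hC i)
    · /- Case γ: the inclusion is loose; Vosper for (Bᵢ, V). -/
      have hBVeq : #(B i + (W ∪ (Sn + Yo))) = b + n - 1 := by omega
      have h2B : 2 ≤ #(B i) := by rw [hb]; omega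
      have h2V : 2 ≤ #(W ∪ (Sn + Yo)) := by rw [hVn]; omega
      have hcrit2 : #(B i + (W ∪ (Sn + Yo))) = #(B i) + #(W ∪ (Sn + Yo)) - 1 := by rw [hb, hVn]; omega
      have hsmall2 : #(B i + (W ∪ (Sn + Yo))) ≤ p - 2 := by omega
      obtain ⟨e', he', hBap, hVap⟩ := vosper_inverse h2B h2V hcrit2 hsmall2
      obtain ⟨β, hβ⟩ := hBap
      obtain ⟨v, hv⟩ := hVap
      rw [hb] at hβ; rw [hVn] at hv
      have hBpairs := pairs_of_apFinset hβ
      obtain ⟨b', rfl⟩ : ∃ b', b = b' + 1 := ⟨b - 1, by omega⟩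
      obtain ⟨hSsub', hgap⟩ := prefix_law_of_runs hS i (SY := Sn + Yo) (N₁ := n) he' hβ hWV hv (by omega)
      rw [hSY, image_affine_apFinset] at hSsub' hgap
      have hval := val_mem_of_nat_table_prime (p := p) (n := n) (m := m) (r := b' + 1) (J := J)
        (by omega) (by omega) htableγ (mul_ne_zero (inv_ne_zero he') hd) hSsub' hgap
      exact false_of_ratio_val_mem_mult hS i hd he' (by omega) (by omega) hJ hval hApairs hBpairs (hC i)


/-! ## The two GO #91 leaves (and `{(2,2,5),(2,4,3),(3,3,2)}`) modulo `HamidouneRodsethCard 3` only -/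

section Kills

/-- The plain target `{0, 1, 60}` meets the arithmetic description (`0`, `±1`). [folklore] -/
theorem target_61_plain : ∀ jv ∈ ({0, 1, 60} : Finset ℕ),
    jv = 0 ∨ (∃ k ∈ range 3, 1 ≤ k ∧ (jv = k ∨ jv + k = 61)) ∨ (∃ k ∈ range 3, 1 ≤ k ∧ (jv * k % 61 = 1 ∨ jv * k % 61 = 61 - 1)) := by
  decide

/-- **`{(2,2,2),(2,3,3),(3,2,3),(3,3,2)}` has no STPP family in `ℤ₆₁`, PROVIDED the Hamidoune–Rødseth theorem for `|S| = 3`** (same reading, block and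
tables as `no_isSTPP_zmod61_222_233_323_332_of_hamidouneRodseth`). [cite: CohnKleinbergSzegedyUmans2005, Def. 5.1]
[cite: HamidouneRodseth2000, main theorem (§1, p. 252)] [cite: Nathanson1996, Thm 2.7] -/
theorem no_isSTPP_zmod61_222_233_323_332_of_hrCard3 (h3 : HamidouneRodsethCard 3)
    (A B C : Fin 4 → Finset (ZMod 61)) (hS : IsSTPP A B C)
    (hA : ∀ i, #(A i) = ![2, 2, 3, 3] i) (hB : ∀ i, #(B i) = ![2, 3, 2, 3] i) (hC : ∀ i, #(C i) = ![2, 3, 3, 2] i) :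
    False := by
  haveI : Fact (Nat.Prime 61) := ⟨prime_61⟩
  have hAne : ∀ i, (A i).Nonempty := fun i => card_pos.1 (by rw [hA]; fin_cases i <;> simp)
  have hBne : ∀ i, (B i).Nonempty := fun i => card_pos.1 (by rw [hB]; fin_cases i <;> simp)
  have hCne : ∀ i, (C i).Nonempty := fun i => card_pos.1 (by rw [hC]; fin_cases i <;> simp)
  have e3 : (univ : Finset (Fin 4)).erase 3 = {0, 1, 2} := by decide
  have hz : ∑ k ∈ (univ : Finset (Fin 4)).erase 3, #(A k) * #(C k) = 19 := by
    rw [e3]; simp [Finset.sum_insert, hA, hC]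
  have hL : ∑ k ∈ (univ : Finset (Fin 4)).erase 3, #(B k) * #(C k) = 19 := by
    rw [e3]; simp [Finset.sum_insert, hB, hC]
  have ha : #(A 3) = 3 := by rw [hA]; simp
  have hb : #(B 3) = 3 := by rw [hB]; simp
  have hvol : #(A 3) * #(B 3) * #(C 3) = 18 := by rw [hA, hB, hC]; simp
  exact no_isSTPP_of_slack_one_tables_prime_card h3 h3 A B C hS hAne hBne hCne 3 ⟨0, by decide⟩ ha hb hvol hz hL (by norm_num) (by norm_num)
    (by norm_num) (by norm_num) (by norm_num) (m := 21) (n := 39) rfl rfl target_61_plain table_39_21_3 tableAlpha_61_40_23_3 tableBeta_61_40_21_3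

/-- **`{(2,2,2),(2,3,3),(2,3,3),(3,2,3)}` has no STPP family in `ℤ₆₁`, PROVIDED the Hamidoune–Rødseth theorem for `|S| = 3`** (reading `(c,a,b)`, as
`no_isSTPP_zmod61_222_233_233_323_of_hamidouneRodseth`). [cite: CohnKleinbergSzegedyUmans2005, Def. 5.1]
[cite: HamidouneRodseth2000, main theorem (§1, p. 252)] [cite: Nathanson1996, Thm 2.7] -/
theorem no_isSTPP_zmod61_222_233_233_323_of_hrCard3 (h3 : HamidouneRodsethCard 3)
    (A B C : Fin 4 → Finset (ZMod 61)) (hS : IsSTPP A B C)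
    (hA : ∀ i, #(A i) = ![2, 2, 2, 3] i) (hB : ∀ i, #(B i) = ![2, 3, 3, 2] i) (hC : ∀ i, #(C i) = ![2, 3, 3, 3] i) :
    False := by
  haveI : Fact (Nat.Prime 61) := ⟨prime_61⟩
  have hS' : IsSTPP C A B := stpp_rotate (stpp_rotate hS)
  have hAne : ∀ i, (A i).Nonempty := fun i => card_pos.1 (by rw [hA]; fin_cases i <;> simp)
  have hBne : ∀ i, (B i).Nonempty := fun i => card_pos.1 (by rw [hB]; fin_cases i <;> simp)
  have hCne : ∀ i, (C i).Nonempty := fun i => card_pos.1 (by rw [hC]; fin_cases i <;> simp)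
  have e3 : (univ : Finset (Fin 4)).erase 3 = {0, 1, 2} := by decide
  have hz : ∑ k ∈ (univ : Finset (Fin 4)).erase 3, #(C k) * #(B k) = 22 := by
    rw [e3]; simp [Finset.sum_insert, hB, hC]
  have hL : ∑ k ∈ (univ : Finset (Fin 4)).erase 3, #(A k) * #(B k) = 16 := by
    rw [e3]; simp [Finset.sum_insert, hA, hB]
  have ha : #(C 3) = 3 := by rw [hC]; simp
  have hb : #(A 3) = 3 := by rw [hA]; simp
  have hvol : #(C 3) * #(A 3) * #(B 3) = 18 := by rw [hA, hB, hC]; simp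
  exact no_isSTPP_of_slack_one_tables_prime_card h3 h3 C A B hS' hCne hAne hBne 3 ⟨0, by decide⟩ ha hb hvol hz hL (by norm_num) (by norm_num)
    (by norm_num) (by norm_num) (by norm_num) (m := 18) (n := 36) rfl rfl target_61_plain table_36_18_3 tableAlpha_61_37_20_3 tableBeta_61_37_18_3

/-- **`{(2,2,5),(2,4,3),(3,3,2)}` has no STPP family in `ℤ₆₁`, PROVIDED the Hamidoune–Rødseth theorem for `|S| = 3`** (reading `(b,a,c)`, as
`no_isSTPP_zmod61_225_243_332_of_hamidouneRodseth`). [cite: CohnKleinbergSzegedyUmans2005, Def. 5.1]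
[cite: HamidouneRodseth2000, main theorem (§1, p. 252)] [cite: Nathanson1996, Thm 2.7] -/
theorem no_isSTPP_zmod61_225_243_332_of_hrCard3 (h3 : HamidouneRodsethCard 3)
    (A B C : Fin 3 → Finset (ZMod 61)) (hS : IsSTPP A B C)
    (hA : ∀ i, #(A i) = ![2, 2, 3] i) (hB : ∀ i, #(B i) = ![2, 4, 3] i) (hC : ∀ i, #(C i) = ![5, 3, 2] i) :
    False := by
  haveI : Fact (Nat.Prime 61) := ⟨prime_61⟩
  have hAne : ∀ i, (A i).Nonempty := fun i => card_pos.1 (by rw [hA]; fin_cases i <;> simp)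
  have hBne : ∀ i, (B i).Nonempty := fun i => card_pos.1 (by rw [hB]; fin_cases i <;> simp)
  have hCne : ∀ i, (C i).Nonempty := fun i => card_pos.1 (by rw [hC]; fin_cases i <;> simp)
  set A' : Fin 3 → Finset (ZMod 61) := fun t => (B t).image Neg.neg with hA'
  set B' : Fin 3 → Finset (ZMod 61) := fun t => (A t).image Neg.neg with hB'
  set C' : Fin 3 → Finset (ZMod 61) := fun t => (C t).image Neg.neg with hC'
  have hS' : IsSTPP A' B' C' := STPP222SqNeg.isSTPP_negSwap (stpp_rotate hS)
  have hcA' : ∀ t, #(A' t) = #(B t) := fun t => Finset.card_image_of_injective _ neg_injective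
  have hcB' : ∀ t, #(B' t) = #(A t) := fun t => Finset.card_image_of_injective _ neg_injective
  have hcC' : ∀ t, #(C' t) = #(C t) := fun t => Finset.card_image_of_injective _ neg_injective
  have hAne' : ∀ t, (A' t).Nonempty := fun t => (hBne t).image _
  have hBne' : ∀ t, (B' t).Nonempty := fun t => (hAne t).image _
  have hCne' : ∀ t, (C' t).Nonempty := fun t => (hCne t).image _
  have e2 : (univ : Finset (Fin 3)).erase 2 = {0, 1} := by decide
  have hz : ∑ k ∈ (univ : Finset (Fin 3)).erase 2, #(A' k) * #(C' k) = 22 := by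
    rw [e2, Finset.sum_pair (by decide)]; simp [hcA', hcC', hB, hC]
  have hL : ∑ k ∈ (univ : Finset (Fin 3)).erase 2, #(B' k) * #(C' k) = 16 := by
    rw [e2, Finset.sum_pair (by decide)]; simp [hcB', hcC', hA, hC]
  have ha : #(A' 2) = 3 := by rw [hcA', hB]; simp
  have hb : #(B' 2) = 3 := by rw [hcB', hA]; simp
  have hvol : #(A' 2) * #(B' 2) * #(C' 2) = 18 := by rw [hcA', hcB', hcC', hA, hB, hC]; simp
  exact no_isSTPP_of_slack_one_tables_prime_card h3 h3 A' B' C' hS' hAne' hBne' hCne' 2 ⟨0, by decide⟩ ha hb hvol hz hL (by norm_num) (by norm_num)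
    (by norm_num) (by norm_num) (by norm_num) (m := 18) (n := 36) rfl rfl target_61_plain table_36_18_3 tableAlpha_61_37_20_3 tableBeta_61_37_18_3

end Kills

end Summit.MatrixMultiplication.OmegaCensus.CubeNB
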